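import Summits.ABC.IUTFork.Cor312VolumesPadicLatticeScaled
import Summits.ABC.IUTFork.Cor312ThetaBoxesDH
import Summits.ABC.IUTFork.Cor312VolumesPadicLatticeBounds
import HarnessLib

/-!
# [IUTchIII] Corollary 3.12, statement — summand-wise scaled log-shell lattices at an UNRAMIFIED odd prime are
# hull-set preimages; the holomorphic hull of their capsule orbit is the SYMMETRISED scaled lattice

Record-only file (D-0012) of the abc-iut cell (Cor. 3.12 sub-crew, seat abc-iut-c312-5, gen 4; the field-factor side of
gen 4's `Cor312VolumesPadicLatticeScaled`, for ANY `p`-adic presentation `P` of c312-1's log-shell carriers); TAKES NO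
SIDE. [IUTchIV] Thm. 1.10 Step (vi) (kurims p. 29): at the places of odd residue characteristic where every `K_v` is
absolutely unramified "the “container of possible images” is precisely equal to the tensor product of log-shells" —
here: the log-shell lattice of every summand IS the normalised packet (abc-iut-c312-3
`inv_two_p_pow_smul_logPacket_eq_normalizedPacket`), so for a scalar function `c` on the summands (all `c(v⃗) ≠ 0`):

* `latticePkS_eq_preimage_hullSet_of_unramified` / `image_factorMap_latticePkS_of_unramified`: the scaled lattice
  `e⁻¹(Π_{v⃗} c(v⃗)·I_{v⃗})` IS the preimage under gen-2's field-factor comparison of the HULL-SET ([IUTchIII] Rmk. 3.9.5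
  (i)(ii), p. 127: "subsets of the form `λ·𝒪`") with block-constant centre `(c(v⃗))_{(v⃗,i)}` (abc-iut-c312-3 `centreOf`),
  and maps ONTO it;
* `holomorphicHull_iUnion_hullSet_centreOf`: the holomorphic hull (campaign-S `holomorphicHull`: the polydisc of the
  coordinate-wise maximal norms) of a union of such hull-sets over a family of scalar functions `c_σ` majorised by a
  block-constant `ĉ` attained coordinate-wise IS the hull-set of centre `ĉ` — with the union bounded and nondegenerate
  (`isBounded_/isNondegenerate_iUnion_hullSet_centreOf`);
* `iota_smul_normalizedPacket_eq_smul`: a translate `ι_a(x)·(R_I)^∼` through ONE tensor factor (Dupuy–Hilado §3.7) by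
  a field element with `‖x‖ ∈ |ℚ_p^×|` IS the `ℚ_p`-scalar multiple `c·(R_I)^∼`, `‖c‖ = ‖x‖`; at an absolutely
  unramified `K_v` EVERY `x ≠ 0` qualifies (`exists_norm_eq_norm_padic_zpow`: the value group is `p^ℤ`).
[cite: Mochizuki2012, IUTchIV Thm 1.10 proof Step (vi) p. 29]; [cite: Mochizuki2012, IUTchIII Rmk. 3.9.5 (i) p. 127];
[cite: DupuyHilado2025, §3.7, §3.9]; [cite: NeukirchANT1999, Ch. II Prop. (3.3)]. Deliberately NOT here: the
`Cor312.Setting` (companion `Cor312HullStableDHVol` over c312-5's `Real.settingDHVol`), Θ-boxes, any judgement.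
-/

noncomputable section

open Set Function NumberField IsDedekindDomain Bornology
open scoped Pointwise

namespace Summit.ABC

namespace IUTFork

namespace Cor312Vol

namespace PadicPresentation

open Thm311 Literature.IUT.LogThetaLattice Literature.IUT.LogVolume

variable {T : ThetaIndex} {L : LogShells T} {vQ : T.VQ} {p : ℕ} [hp : Fact p.Prime] (P : PadicPresentation L vQ p)
  {j : T.Label}

/-! ## 1. Scaled lattices at an unramified odd prime are hull-set preimages -/

/-- At an odd prime with every `K_v`, `v | p`, absolutely unramified and `j ≥ 1`, the log-shell lattice of each summand
IS the normalised packet: `I_{v⃗} = (R_{v⃗})^∼` (abc-iut-c312-3 `inv_two_p_pow_smul_logPacket_eq_normalizedPacket`).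
[cite: Mochizuki2012, IUTchIV Thm 1.10 proof Step (vi) p. 29] -/
theorem logShell_eq_normalizedPacket_of_unramified (hp2 : 2 < p) (hj : 2 ≤ Fintype.card (T.Caps j))
    (he : ∀ v : T.Fibre vQ, absRamificationIdx p (P.k v) = 1) (e : T.Caps j → T.Fibre vQ) :
    logShell p (P.kk e) = (normalizedPacket p (P.kk e) : Set (P.X e)) :=
  inv_two_p_pow_smul_logPacket_eq_normalizedPacket p (P.kk e) hj hp2 fun a => he (e a)

/-- … so the scaled lattice is `e⁻¹(Π_{v⃗} c(v⃗)·(R_{v⃗})^∼)`. [cite: Mochizuki2012, IUTchIV Thm 1.10 proof Step (vi) p. 29] -/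
theorem latticePkS_eq_of_unramified (hp2 : 2 < p) (hj : 2 ≤ Fintype.card (T.Caps j))
    (he : ∀ v : T.Fibre vQ, absRamificationIdx p (P.k v) = 1) (c : (T.Caps j → T.Fibre vQ) → ℚ_[p]) :
    P.latticePkS j c =
      P.comparison j ⁻¹' Set.pi univ fun e => c e • (normalizedPacket p (P.kk e) : Set (P.X e)) := by
  unfold latticePkS summandLatticeS
  congr 2
  funext e
  rw [P.logShell_eq_normalizedPacket_of_unramified hp2 hj he e]

/-- The block-constant centre `(c(v⃗))_{(v⃗,i)}` of the field-factor product (abc-iut-c312-3 `centreOf` of the scalars).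
[folklore] -/
theorem centreOf_algebraMap_apply (c : (T.Caps j → T.Fibre vQ) → ℚ_[p]) (s : P.factorIdx j) :
    P.centreOf (fun e => algebraMap ℚ_[p] (P.X e) (c e)) s = algebraMap ℚ_[p] (P.factorField j s) (c s.1) := by
  haveI : Nonempty (T.Caps j) := ⟨0⟩
  show dEquiv p (P.kk s.1) (algebraMap ℚ_[p] (P.X s.1) (c s.1)) s.2 = _
  rw [AlgEquiv.commutes, Pi.algebraMap_apply]

/-- … whose `(v⃗,i)`-component has norm `‖c(v⃗)‖`. [folklore] -/
theorem norm_centreOf_algebraMap (c : (T.Caps j → T.Fibre vQ) → ℚ_[p]) (s : P.factorIdx j) :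
    ‖P.centreOf (fun e => algebraMap ℚ_[p] (P.X e) (c e)) s‖ = ‖c s.1‖ := by
  rw [P.centreOf_algebraMap_apply, norm_algebraMap']

/-- **At an unramified odd prime the scaled lattice `e⁻¹(Π_{v⃗} c(v⃗)·I_{v⃗})` (all `c(v⃗) ≠ 0`) IS the field-factor
preimage of the hull-set with block-constant centre `(c(v⃗))_{(v⃗,i)}`** (c312-3 `factorMap_preimage_hullSet_centreOf`).
[cite: Mochizuki2012, IUTchIII Rmk. 3.9.5 (ii) p. 127] -/
theorem latticePkS_eq_preimage_hullSet_of_unramified (hp2 : 2 < p) (hj : 2 ≤ Fintype.card (T.Caps j))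
    (he : ∀ v : T.Fibre vQ, absRamificationIdx p (P.k v) = 1) {c : (T.Caps j → T.Fibre vQ) → ℚ_[p]}
    (hc : ∀ e, c e ≠ 0) :
    P.latticePkS j c = (fun x => P.factorMap j x) ⁻¹'
      hullSet (P.factorField j) (P.centreOf fun e => algebraMap ℚ_[p] (P.X e) (c e)) := by
  haveI : Nonempty (T.Caps j) := ⟨0⟩
  rw [P.factorMap_preimage_hullSet_centreOf _ fun e i => dEquiv_algebraMap_ne_zero p (P.kk e) (hc e) i,
    P.latticePkS_eq_of_unramified hp2 hj he c]
  congr 2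
  funext e
  exact smul_set_eq_algebraMap_smul p (P.kk e) (c e) _

/-- … and its image under the (onto) field-factor comparison IS that hull-set. [cite: Mochizuki2012, IUTchIII Rmk. 3.9.5 (ii) p. 127] -/
theorem image_factorMap_latticePkS_of_unramified (hp2 : 2 < p) (hj : 2 ≤ Fintype.card (T.Caps j))
    (he : ∀ v : T.Fibre vQ, absRamificationIdx p (P.k v) = 1) {c : (T.Caps j → T.Fibre vQ) → ℚ_[p]}
    (hc : ∀ e, c e ≠ 0) :
    (fun x => P.factorMap j x) '' P.latticePkS j c =
      hullSet (P.factorField j) (P.centreOf fun e => algebraMap ℚ_[p] (P.X e) (c e)) := by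
  rw [P.latticePkS_eq_preimage_hullSet_of_unramified hp2 hj he hc]
  exact Set.image_preimage_eq _ (P.factorMap_surjective j)

/-- Hull-sets with block-constant centres are monotone in the norms of the scalars. [folklore] -/
theorem hullSet_centreOf_subset_of_norm_le {c c' : (T.Caps j → T.Fibre vQ) → ℚ_[p]} (h : ∀ e, ‖c e‖ ≤ ‖c' e‖) :
    hullSet (P.factorField j) (P.centreOf fun e => algebraMap ℚ_[p] (P.X e) (c e)) ⊆
      hullSet (P.factorField j) (P.centreOf fun e => algebraMap ℚ_[p] (P.X e) (c' e)) := by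
  unfold hullSet
  refine polydisc_mono _ fun s => ?_
  rw [P.norm_centreOf_algebraMap, P.norm_centreOf_algebraMap]
  exact h s.1

/-- **The holomorphic hull of a union of hull-sets with block-constant centres `(c_σ(v⃗))`, over a family `σ`
attaining a block-constant bound `ĉ` (all `ĉ(v⃗) ≠ 0`), is the hull-set of centre `ĉ`** — campaign-S `holomorphicHull`
is the polydisc of the coordinate-wise maximal norms. [cite: Mochizuki2012, IUTchIII Rmk. 3.9.5 (i) p. 127] -/
theorem holomorphicHull_iUnion_hullSet_centreOf [Fintype (P.factorIdx j)] {ι : Type} [Nonempty ι]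
    (cs : ι → (T.Caps j → T.Fibre vQ) → ℚ_[p]) {ĉ : (T.Caps j → T.Fibre vQ) → ℚ_[p]} (hĉ0 : ∀ e, ĉ e ≠ 0)
    (hle : ∀ σ e, ‖cs σ e‖ ≤ ‖ĉ e‖) (hatt : ∀ e, ∃ σ, ‖cs σ e‖ = ‖ĉ e‖) :
    holomorphicHull (P.factorField j)
        (⋃ σ, hullSet (P.factorField j) (P.centreOf fun e => algebraMap ℚ_[p] (P.X e) (cs σ e))) =
      hullSet (P.factorField j) (P.centreOf fun e => algebraMap ℚ_[p] (P.X e) (ĉ e)) := by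
  set U : Set (∀ s : P.factorIdx j, P.factorField j s) :=
    ⋃ σ, hullSet (P.factorField j) (P.centreOf fun e => algebraMap ℚ_[p] (P.X e) (cs σ e)) with hU
  have hsub : U ⊆ hullSet (P.factorField j) (P.centreOf fun e => algebraMap ℚ_[p] (P.X e) (ĉ e)) :=
    Set.iUnion_subset fun σ => P.hullSet_centreOf_subset_of_norm_le (hle σ)
  have hb : Bornology.IsBounded U := (isBounded_hullSet _ _).subset hsub
  apply Set.Subset.antisymm
  · refine holomorphicHull_subset_of_isHullSet _ ⟨_, fun s => ?_, rfl⟩ hsub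
    rw [← norm_pos_iff, P.norm_centreOf_algebraMap, norm_pos_iff]
    exact hĉ0 s.1
  · rw [holomorphicHull_of_isBounded _ hb]
    unfold hullSet
    refine polydisc_mono _ fun s => ?_
    obtain ⟨σ, hσ⟩ := hatt s.1
    rw [P.norm_centreOf_algebraMap, ← hσ, ← P.norm_centreOf_algebraMap (cs σ) s]
    refine norm_apply_le_hullRadius _ hb (Set.mem_iUnion.2 ⟨σ, ?_⟩) s
    exact (mem_polydisc _).2 fun _ => le_rfl


/-- The union of such hull-sets is bounded … [folklore] -/
theorem isBounded_iUnion_hullSet_centreOf [Fintype (P.factorIdx j)] {ι : Type}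
    (cs : ι → (T.Caps j → T.Fibre vQ) → ℚ_[p]) {ĉ : (T.Caps j → T.Fibre vQ) → ℚ_[p]}
    (hle : ∀ σ e, ‖cs σ e‖ ≤ ‖ĉ e‖) :
    Bornology.IsBounded (⋃ σ, hullSet (P.factorField j) (P.centreOf fun e => algebraMap ℚ_[p] (P.X e) (cs σ e))) :=
  (isBounded_hullSet _ _).subset (Set.iUnion_subset fun σ => P.hullSet_centreOf_subset_of_norm_le (hle σ))

/-- … and nondegenerate (each member is a hull-set with nonzero centre). [folklore] -/
theorem isNondegenerate_iUnion_hullSet_centreOf {ι : Type} [Nonempty ι]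
    (cs : ι → (T.Caps j → T.Fibre vQ) → ℚ_[p]) (hcs : ∀ σ e, cs σ e ≠ 0) :
    IsNondegenerate (P.factorField j)
      (⋃ σ, hullSet (P.factorField j) (P.centreOf fun e => algebraMap ℚ_[p] (P.X e) (cs σ e))) := by
  obtain ⟨σ⟩ := ‹Nonempty ι›
  intro s
  obtain ⟨u, hu, hne⟩ := (IsHullSet.isNondegenerate (P.factorField j) ⟨_, fun s => by
    rw [← norm_pos_iff, P.norm_centreOf_algebraMap, norm_pos_iff]; exact hcs σ s.1, rfl⟩) s
  exact ⟨u, Set.mem_iUnion.2 ⟨σ, hu⟩, hne⟩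


/-- **A translate `ι_a(x)·(R_I)^∼` by a field element whose norm lies in `|ℚ_p^×|` IS a `ℚ_p`-scalar multiple of
`(R_I)^∼`**: both are the preimage of the polydisc of radii `‖x‖ = ‖c‖` (campaign-S `norm_dEquiv_iota`; c312-3
`preimage_dEquiv_hullSet`). At an unramified place every `x ≠ 0` qualifies (`exists_norm_eq_norm_padic_zpow`).
[cite: DupuyHilado2025, §3.7] -/
theorem iota_smul_normalizedPacket_eq_smul (e : T.Caps j → T.Fibre vQ) (a₀ : T.Caps j) {x : P.kk e a₀} (hx : x ≠ 0)
    {c : ℚ_[p]} (hxc : ‖x‖ = ‖c‖) :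
    iota p (P.kk e) a₀ x • (normalizedPacket p (P.kk e) : Set (P.X e)) =
      c • (normalizedPacket p (P.kk e) : Set (P.X e)) := by
  haveI : Nonempty (T.Caps j) := ⟨a₀⟩
  have hc : c ≠ 0 := by
    rw [← norm_ne_zero_iff, ← hxc, norm_ne_zero_iff]
    exact hx
  rw [smul_set_eq_algebraMap_smul p (P.kk e) c, ← P.preimage_dEquiv_hullSet e _ (dEquiv_iota_ne_zero p (P.kk e) a₀ hx),
    ← P.preimage_dEquiv_hullSet e _ (dEquiv_algebraMap_ne_zero p (P.kk e) hc)]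
  unfold hullSet
  congr 2
  funext i
  rw [norm_dEquiv_iota, AlgEquiv.commutes, Pi.algebraMap_apply, norm_algebraMap', hxc]

end PadicPresentation
open Literature.IUT.LogVolume in
/-- At an ABSOLUTELY UNRAMIFIED `K_v` the norm of every `x ≠ 0` is the norm of a power of `p ∈ ℚ_p` (the value group
is `p^ℤ`; campaign-S `exists_norm_eq_rpow`). [cite: NeukirchANT1999, Ch. II Prop. (3.3)] -/
theorem exists_norm_eq_norm_padic_zpow (p : ℕ) [Fact p.Prime] (K : Type) [NontriviallyNormedField K]
    [NormedAlgebra ℚ_[p] K] [IsUltrametricDist K] [ProperSpace K] (he : absRamificationIdx p K = 1) {x : K}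
    (hx : x ≠ 0) : ∃ m : ℤ, ‖x‖ = ‖(p : ℚ_[p]) ^ m‖ := by
  obtain ⟨m, hm⟩ := exists_norm_eq_rpow p K hx
  refine ⟨m, ?_⟩
  rw [hm, he, norm_zpow, Padic.norm_p, Nat.cast_one, div_one, inv_zpow, ← zpow_neg, ← Real.rpow_intCast]
  push_cast
  rfl

end Cor312Vol

end IUTFork

end Summit.ABC

end
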